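import Summits.RiemannHypothesis.RiemannHypothesis.Theorems.MotivicDoor.AWS.Levels
import Literature.NumberTheory.LFunctions.WeilTwoPrimePos59

/-!
# Levels of the `ArithmeticWeilSurface` axiom system, II: levelwise forcing

(pub-rhdoor cell, seat cc-4 = the forcing lemma; kernel form of AXIOM-CONTENT.md §2 "FINITE
LEVELS" and of carrier-1's CARRIER-DESIGN F1; part I is `AWS.Levels`.)

HONEST LABEL (verbatim, binding).  The sprint theorem `riemannHypothesis_of_arithmeticWeilSurface`
is a one-way implication from a strengthened, prime-side-only axiom system; the existence of such
an object is NOT claimed and is the located gap; the converse (RH ⇒ existence) is out of scope —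
and, for this axiom system, tautological rather than informative (AXIOM-CONTENT.md §2;
`riemannHypothesis_iff_exists_tautologicalCarrier`,
`nonempty_arithmeticWeilSurface_iff_riemannHypothesis`).  VERDICT (AXIOM-CONTENT.md §0,
referee-signed): `Nonempty ArithmeticWeilSurface` is a restatement of RH in structure clothing,
not a different-looking hypothesis.  FRAMING: lottery ticket at the motivic door; RH probability
negligible; consolation prizes are real: a new semi-local Weil-positivity theorem, or a located
gap in the Connes–Consani programme, plus the ff-door theorem.

## What this file proves (sorry-free; nothing here is evidence for RH)

* `levelCarrier`, `nonempty_level_iff_levelPos` — A LEVEL CERTIFIES FINITE WEIL POSITIVITY AND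
  NOTHING ELSE: `Nonempty (G.Level s) ↔ G.LevelPos s` (`←` is the canonical prime-side carrier
  with its form pulled back along the projection onto the generators in `s`; all axioms by
  construction, the sign condition being exactly `LevelPos s`).
* `riemannHypothesis_iff_forall_levelPos`, `riemannHypothesis_iff_forall_nonempty_level` —
  LEVELWISE FORCING: `RH ↔ ∀ s, G.LevelPos s ↔ ∀ s, Nonempty (G.Level s)` for ANY generating
  family; and `riemannHypothesis_of_levels`: realisations of a cofinal family of levels — with NO
  compatibility maps between them — imply RH.  So a realisation tower is a candidate hypothesis of
  a kernel-checked implication, and that hypothesis is, level by level, finite Weil positivity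
  (a case of Weil's criterion; what `weilobs` already certifies).
* `levelPos_of_weilPositivityOn`, `nonempty_level_of_tsupport_subset` — UNCONDITIONAL LEVELS: a
  level all of whose generators are supported in `[-a, a]` with `WeilPositivityOn a` a THEOREM
  (in tree: `a = 59/100`, `weilPositivityOn_59_100`) is realisable now, without RH.  Finite levels
  are satisfiable in proved regimes and carry no information beyond them.
* `ArithmeticWeilSurface.level` — every arithmetic Weil surface truncates to the full compatible
  tower of levels (fields verbatim).
-/

noncomputable section

open Complex Set MeasureTheory Literature.NumberTheory.LFunctions
open Literature.NumberTheory.ConnesConsani2019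
open Summit.RiemannHypothesis.RiemannHypothesis.Theorems.MotivicDoor.ConnesConsani
open Summit.RiemannHypothesis.RiemannHypothesis.Theorems.PfPersistence
open scoped BigOperators ComplexConjugate

namespace Summit.RiemannHypothesis.RiemannHypothesis.Theorems.MotivicDoor.AWS

namespace GeneratingFamily

variable (G : GeneratingFamily)

/-! ## The canonical carrier of a level -/

section Carrier

variable (s : Finset G.ι) [DecidablePred (· ∈ s)]

/-- Projection of the free lattice onto the generators in `s` (the rulings untouched). -/
def levelProj : G.PrimeLattice →+ G.PrimeLattice :=
  AddMonoidHom.mk' (fun x ↦ (x.1.filter (· ∈ s), x.2)) fun x y ↦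
    Prod.ext (by simp [Finsupp.filter_add]) rfl

/-- Unfolding `levelProj`. -/
@[simp] theorem levelProj_apply (x : G.PrimeLattice) :
    G.levelProj s x = (x.1.filter (· ∈ s), x.2) := rfl

/-- The projection fixes the vectors supported in `s`. -/
theorem levelProj_of_subset {x : G.PrimeLattice} (hx : x.1.support ⊆ s) : G.levelProj s x = x := by
  rw [levelProj_apply, (Finsupp.filter_eq_self_iff _ _).2 fun i hi ↦ hx (Finsupp.mem_support_iff.2 hi)]

/-- The projection lands in the vectors supported in `s`. -/
theorem support_levelProj (x : G.PrimeLattice) : (G.levelProj s x).1.support ⊆ s := fun i hi ↦ by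
  rw [levelProj_apply, Finsupp.support_filter] at hi
  exact (Finset.mem_filter.1 hi).2

/-- The level-`s` form: the decreed pairing pulled back along the projection (degenerate off `s`). -/
def levelForm : G.PrimeLattice →+ G.PrimeLattice →+ ℝ :=
  (G.primeInter.comp (G.levelProj s)).compl₂ (G.levelProj s)

/-- Unfolding `levelForm`. -/
@[simp] theorem levelForm_apply (x y : G.PrimeLattice) :
    G.levelForm s x y = G.primeInter (G.levelProj s x) (G.levelProj s y) := rfl

/-- The projection fixes `e₁`. -/
theorem levelProj_primeE₁ : G.levelProj s G.primeE₁ = G.primeE₁ :=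
  G.levelProj_of_subset s (by simp [primeE₁])

/-- The projection fixes `e₂`. -/
theorem levelProj_primeE₂ : G.levelProj s G.primeE₂ = G.primeE₂ :=
  G.levelProj_of_subset s (by simp [primeE₂])

variable {G s} in
/-- **The canonical carrier of level `s`** (free lattice, decreed form projected to `s`): every
axiom of the level holds BY CONSTRUCTION except the sign condition, which is exactly finite Weil
positivity at level `s`. -/
def levelCarrier (h : G.LevelPos s) : G.Level s where
  L := G.PrimeLattice
  inter := G.levelForm s
  inter_comm x y := by rw [levelForm_apply, levelForm_apply, primeInter_comm]
  e₁ := G.primeE₁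
  e₂ := G.primeE₂
  inter_e₁_e₁ := by rw [levelForm_apply, levelProj_primeE₁, primeInter_e₁_e₁]
  inter_e₂_e₂ := by rw [levelForm_apply, levelProj_primeE₂, primeInter_e₂_e₂]
  inter_e₁_e₂ := by rw [levelForm_apply, levelProj_primeE₁, levelProj_primeE₂, primeInter_e₁_e₂]
  frob := G.primeFrob
  frob_e₁ c hc := by
    rw [sum_smul_primeFrob, levelForm_apply, G.levelProj_of_subset s (x := (c, 0, 0)) hc,
      levelProj_primeE₁, primeInter_e₁_right]
    simp [dstarHom_apply]
  frob_e₂ c hc := by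
    rw [sum_smul_primeFrob, levelForm_apply, G.levelProj_of_subset s (x := (c, 0, 0)) hc,
      levelProj_primeE₂, primeInter_e₂_right]
    simp [duHom_apply]
  frob_frob c hc := by
    have hf := G.primeFrob_frob c
    rw [sum_smul_primeFrob] at hf ⊢
    rw [levelForm_apply, G.levelProj_of_subset s (x := (c, 0, 0)) hc]
    exact hf
  hodge n v a h₁ h₂ := by
    simp only [levelForm_apply, levelProj_primeE₁, levelProj_primeE₂] at h₁ h₂ ⊢
    rw [G.sum_sum_primeInter n (fun k ↦ G.levelProj s (v k)) a, h₁, h₂]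
    have h0 : 0 ≤ (weilQuadratic fun t ↦ ∑ k, (a k : ℂ) * G.ctest (G.levelProj s (v k)).1 t).re :=
      h.sum_ctest_nonneg (fun k ↦ (G.levelProj s (v k)).1) (fun k ↦ G.support_levelProj s (v k)) a
    linarith

end Carrier

/-! ## Levelwise forcing -/

/-- **A level is realisable iff finite Weil positivity holds at that level** — a level of the
axiom system certifies a finite case of Weil's criterion and nothing else. -/
theorem nonempty_level_iff_levelPos (s : Finset G.ι) : Nonempty (G.Level s) ↔ G.LevelPos s := by
  classical
  exact ⟨fun ⟨Y⟩ ↦ Y.levelPos, fun h ↦ ⟨levelCarrier h⟩⟩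

/-- Positivity at a level implies positivity at every lower level. -/
theorem levelPos_anti {s t : Finset G.ι} (h : t ⊆ s) (hs : G.LevelPos s) : G.LevelPos t := by
  classical
  exact ((levelCarrier hs).restrict h).levelPos

/-- **RH ⇒ finite positivity at every level** (the easy direction of Weil's criterion). -/
theorem levelPos_of_riemannHypothesis (hRH : _root_.RiemannHypothesis) (s : Finset G.ι) :
    G.LevelPos s := fun r ↦
  (show _root_.RiemannHypothesis ↔ WeilPositivity from weil_criterion_holds).mp hRH _
    (isWeilTest_finset_sum s fun i _ ↦ (G.isWeilTest i).const_mul (r i : ℂ))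

/-- **LEVELWISE FORCING**: RH ↔ finite Weil positivity at every level of the generating family
(any generating family; `←` is the tautological carrier: positivity on all real combinations of
integer combinations is the sign condition of the canonical carrier, `riemannHypothesis_of_primeHodge`). -/
theorem riemannHypothesis_iff_forall_levelPos :
    _root_.RiemannHypothesis ↔ ∀ s : Finset G.ι, G.LevelPos s := by
  classical
  refine ⟨G.levelPos_of_riemannHypothesis, fun h ↦ G.riemannHypothesis_of_primeHodge ?_⟩
  intro n v a h₁ h₂
  rw [G.sum_sum_primeInter, h₁, h₂]
  have h0 : 0 ≤ (weilQuadratic fun t ↦ ∑ k, (a k : ℂ) * G.ctest (v k).1 t).re :=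
    (h (Finset.univ.biUnion fun k ↦ (v k).1.support)).sum_ctest_nonneg (fun k ↦ (v k).1)
      (fun k ↦ Finset.subset_biUnion_of_mem (fun k ↦ (v k).1.support) (Finset.mem_univ k)) a
  linarith

/-- **LEVELWISE FORCING (structure form)**: RH holds iff EVERY level of the axiom system is
realisable.  With `nonempty_level_iff_levelPos`: a realisation of level `s` is worth exactly the
finite positivity statement `LevelPos s`, no more. -/
theorem riemannHypothesis_iff_forall_nonempty_level :
    _root_.RiemannHypothesis ↔ ∀ s : Finset G.ι, Nonempty (G.Level s) := by
  simp only [nonempty_level_iff_levelPos]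
  exact G.riemannHypothesis_iff_forall_levelPos

/-- **Any realisation tower forces RH**: realisations of a cofinal family of levels — with NO
compatibility between them required — imply RH ("any realisation tower is a candidate hypothesis
of a kernel-checked implication"; the hypothesis is, level by level, finite Weil positivity). -/
theorem riemannHypothesis_of_levels {α : Type*} (S : α → Finset G.ι)
    (hS : ∀ s : Finset G.ι, ∃ n, s ⊆ S n) (Y : ∀ n, G.Level (S n)) : _root_.RiemannHypothesis :=
  G.riemannHypothesis_iff_forall_nonempty_level.2 fun s ↦ by
    obtain ⟨n, hn⟩ := hS s
    exact ⟨(Y n).restrict hn⟩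

/-! ## Unconditional levels: generators supported where Weil positivity is a theorem -/

/-- A real combination of generators supported in `[-a, a]` is supported in `[-a, a]`. -/
theorem tsupport_sum_subset {s : Finset G.ι} {a : ℝ} (hs : ∀ i ∈ s, tsupport (G.φ i) ⊆ Icc (-a) a)
    (r : G.ι → ℝ) : tsupport (fun t ↦ ∑ i ∈ s, (r i : ℂ) * (G.φ i t : ℂ)) ⊆ Icc (-a) a := by
  refine closure_minimal (fun t ht ↦ ?_) isClosed_Icc
  by_contra hta
  refine ht (Finset.sum_eq_zero fun i hi ↦ ?_)
  have h0 : G.φ i t = 0 := image_eq_zero_of_notMem_tsupport fun h ↦ hta (hs i hi h)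
  simp [h0]

/-- **Proved Weil positivity on `[-a, a]` gives finite positivity at every level supported there.** -/
theorem levelPos_of_weilPositivityOn {a : ℝ} (ha : WeilPositivityOn a) {s : Finset G.ι}
    (hs : ∀ i ∈ s, tsupport (G.φ i) ⊆ Icc (-a) a) : G.LevelPos s := fun r ↦
  ha _ (isWeilTest_finset_sum s fun i _ ↦ (G.isWeilTest i).const_mul (r i : ℂ))
    (G.tsupport_sum_subset hs r)

/-- **Unconditional levels** (in tree: the two-prime certificate `weilPositivityOn_59_100`): every
level whose generators are supported in `[-59/100, 59/100]` is realisable — no hypothesis, no RH.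
Finite levels are satisfiable in proved regimes; they carry no information beyond those regimes. -/
theorem nonempty_level_of_tsupport_subset {s : Finset G.ι}
    (hs : ∀ i ∈ s, tsupport (G.φ i) ⊆ Icc (-(59 / 100 : ℝ)) (59 / 100)) : Nonempty (G.Level s) :=
  (G.nonempty_level_iff_levelPos s).2 (G.levelPos_of_weilPositivityOn weilPositivityOn_59_100 hs)

end GeneratingFamily

namespace ArithmeticWeilSurface

/-- **Every arithmetic Weil surface truncates to every level of its generating family** (fields
verbatim): an actual object would provide the whole compatible tower of level realisations. -/
def level (X : ArithmeticWeilSurface) (s : Finset X.gen.ι) : X.gen.Level s where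
  L := X.L
  inter := X.inter
  inter_comm := X.inter_comm
  e₁ := X.e₁
  e₂ := X.e₂
  inter_e₁_e₁ := X.inter_e₁_e₁
  inter_e₂_e₂ := X.inter_e₂_e₂
  inter_e₁_e₂ := X.inter_e₁_e₂
  frob := X.frob
  frob_e₁ c _ := X.frob_e₁ c
  frob_e₂ c _ := X.frob_e₂ c
  frob_frob c _ := X.frob_frob c
  hodge := X.hodge

/-- The finite shadow of forcing: an arithmetic Weil surface certifies finite Weil positivity at
every level of its family (and, by `riemannHypothesis_of_arithmeticWeilSurface`, all of RH). -/
theorem levelPos (X : ArithmeticWeilSurface) (s : Finset X.gen.ι) : X.gen.LevelPos s :=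
  (X.level s).levelPos

end ArithmeticWeilSurface

end Summit.RiemannHypothesis.RiemannHypothesis.Theorems.MotivicDoor.AWS
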